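import Literature.Probability.Percolation.IntPairMenger
import HarnessLib

/-!
# The inner pair step: contraction of the fences and two clean routes (twin of `TrapPairContract.lean`)

Topic `Literature/Probability/Percolation`; family `crit-perc` / near-critical percolation on `𝕋`.
A brick of the INNER half of the near-critical arm-separation theorem for four arms in the ADJACENT
colour arrangement (P. Nolin, EJP 13 (2008), Thm. 11, `j = 4`, `σ = BBWW` [arXiv 0711.4948:
Thm. 10], §4.4 Lemma 15, internal extremities, last paragraph of the proof). Word-for-word twin of
`TrapPairContract.lean` in the setting `IntPairData`: `FF`, `Bset`, `AdjF`, the contracted graph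
`cG`, `cA`, `cRoute_of_route`, `canonical_route`, `hcut_cG`, `exists_two_clean_routes`,
`clean_route_subset_Aset`, `clean_route_disjoint_fence`, `clean_route_interior`.

Everything here is proved; no named facts are introduced.

## References

* P. Nolin, Near-critical percolation in two dimensions, *Electron. J. Probab.* 13 (2008), §4.4,
  proof of Lemma 15, internal extremities (arXiv 0711.4948: Lemma 14), last paragraph [Nolin2008].
* R. Diestel, *Graph Theory*, 5th ed. (2017), Thm. 3.3.1 (Menger) and §1.7 (contraction) [Diestel2017].
-/

noncomputable section

open Set

namespace Literature.Probability.Percolation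

open LatticeModels HalfAnnulus Literature.Combinatorics.SimpleGraph

namespace IntPairData

variable {m N k₀ K T R₀ : ℕ} {ω : SiteConfig (Site 2)}

/-! ### Fence sites, non-fence admissible sites, the contracted graph -/

/-- **All fence sites**: the union of the connections `F_u` of the fences of the terms. [folklore] -/
def FF (D : IntPairData m N k₀ K T R₀ ω) : Set (Site 2) :=
  {v | ∃ (u : ℕ) (c : Finset (Site 2)) (z : Site 2) (hu : (intDom m).lowestSeq ω u = some (c, z)), v ∈ (D.fence hu).F}

/-- **The non-fence admissible sites**: the arms and the terms. [folklore] -/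
def Bset (D : IntPairData m N k₀ K T R₀ ω) : Set (Site 2) :=
  D.armSet ∪ {v | ∃ (u : ℕ) (c : Finset (Site 2)) (z : Site 2) (_ : (intDom m).lowestSeq ω u = some (c, z)),
    v ∈ (↑c : Set (Site 2))}

/-- `Bset ⊆ Aset`. [folklore] -/
theorem Bset_subset_Aset (D : IntPairData m N k₀ K T R₀ ω) : D.Bset ⊆ D.Aset := by
  rintro v (hv | ⟨u, c, z, hu, hv⟩)
  · exact D.armSet_subset_Aset hv
  · exact D.term_subset_Aset hu hv

/-- A non-fence admissible site lies in `Bset`. [folklore] -/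
theorem mem_Bset_of_mem_Aset (D : IntPairData m N k₀ K T R₀ ω) {v : Site 2} (hv : v ∈ D.Aset) (hvF : v ∉ D.FF) : v ∈ D.Bset := by
  rcases hv with hv | ⟨u, c, z, hu, hv | hv⟩
  · exact Or.inl hv
  · exact Or.inr ⟨u, c, z, hu, hv⟩
  · exact absurd ⟨u, c, z, hu, hv⟩ hvF

/-- Arms and terms are not fence sites. [folklore] -/
theorem not_mem_FF_of_mem_Bset (D : IntPairData m N k₀ K T R₀ ω) {v : Site 2} (hv : v ∈ D.Bset) : v ∉ D.FF := by
  rintro ⟨u, c, z, hu, hvF⟩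
  rcases hv with hv | ⟨u', c', z', hu', hv⟩
  · exact D.fence_disjoint_arm hu hvF hv
  · exact D.fence_disjoint_term hu hu' hvF (Finset.mem_coe.1 hv)

/-- The targets are fence sites. [folklore] -/
theorem Tset_subset_FF (D : IntPairData m N k₀ K T R₀ ω) : D.Tset ⊆ D.FF := by
  rintro v ⟨u, c, z, hu, rfl⟩
  exact ⟨u, c, z, hu, (D.fence hu).m'_mem⟩

/-- The far ends are non-fence admissible sites. [folklore] -/
theorem b_mem_Bset (D : IntPairData m N k₀ K T R₀ ω) (i : Fin 2) : D.b i ∈ D.Bset :=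
  Or.inl (D.mem_armSet (D.A i).start_mem_support)

/-- **Adjacency to a fence**: `mm` is the end point of the fence of some term and `x` is
`𝕋`-adjacent to a site of its connection. [folklore] -/
def AdjF (D : IntPairData m N k₀ K T R₀ ω) (x mm : Site 2) : Prop :=
  ∃ (u : ℕ) (c : Finset (Site 2)) (z : Site 2) (hu : (intDom m).lowestSeq ω u = some (c, z)),
    mm = (D.fence hu).m' ∧ ∃ f ∈ (D.fence hu).F, triGraph.Adj x f

/-- **The contracted graph**: `𝕋`-adjacency between non-fence sites, and a non-fence site joined
to the end point of every fence it is adjacent to. [cite: Diestel2017, §1.7] -/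
def cG (D : IntPairData m N k₀ K T R₀ ω) : SimpleGraph (Site 2) where
  Adj x y := x ≠ y ∧ ((x ∉ D.FF ∧ y ∉ D.FF ∧ triGraph.Adj x y) ∨ (x ∉ D.FF ∧ D.AdjF x y) ∨ (y ∉ D.FF ∧ D.AdjF y x))
  symm := ⟨fun _ _ ⟨hne, h⟩ => ⟨hne.symm, by
    rcases h with h | h | h
    · exact Or.inl ⟨h.2.1, h.1, h.2.2.symm⟩
    · exact Or.inr (Or.inr h)
    · exact Or.inr (Or.inl h)⟩⟩
  loopless := ⟨fun _ h => h.1 rfl⟩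

/-- The admissible vertices of the contracted graph: arms, terms, end points. [folklore] -/
def cA (D : IntPairData m N k₀ K T R₀ ω) : Set (Site 2) := D.Bset ∪ D.Tset

/-- A `𝕋`-path through non-fence sites is a path of the contracted graph. [folklore] -/
theorem pathIn_cG_of_pathIn (D : IntPairData m N k₀ K T R₀ ω) {X : Set (Site 2)} {x y : Site 2}
    (h : PathIn triGraph X x y) (hX : ∀ v ∈ X, v ∉ D.FF) : PathIn D.cG X x y := by
  obtain ⟨hx, h⟩ := h
  refine ⟨hx, ?_⟩
  induction h with
  | refl => exact Relation.ReflTransGen.refl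
  | @tail b c hb hbc ih =>
    have hbX : b ∈ X := (show PathIn triGraph X x b from ⟨hx, hb⟩).right_mem
    exact ih.tail ⟨⟨hbc.1.ne, Or.inl ⟨hX b hbX, hX c hbc.2, hbc.1⟩⟩, hbc.2⟩

/-- A path of the contracted graph through non-fence sites is a `𝕋`-path. [folklore] -/
theorem pathIn_of_pathIn_cG (D : IntPairData m N k₀ K T R₀ ω) {X : Set (Site 2)} {x y : Site 2}
    (h : PathIn D.cG X x y) (hX : ∀ v ∈ X, v ∉ D.FF) : PathIn triGraph X x y := by
  obtain ⟨hx, h⟩ := h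
  refine ⟨hx, ?_⟩
  induction h with
  | refl => exact Relation.ReflTransGen.refl
  | @tail b c hb hbc ih =>
    have hbX : b ∈ X := (show PathIn D.cG X x b from ⟨hx, hb⟩).right_mem
    have hadj : triGraph.Adj b c := by
      rcases hbc.1.2 with h | h | h
      · exact h.2.2
      · obtain ⟨u, c', z, hu, hm, -⟩ := h.2
        exact absurd (show c ∈ D.FF by rw [hm]; exact D.Tset_subset_FF (D.m'_mem_Tset hu)) (hX c hbc.2)
      · obtain ⟨u, c', z, hu, hm, -⟩ := h.2
        exact absurd (show b ∈ D.FF by rw [hm]; exact D.Tset_subset_FF (D.m'_mem_Tset hu)) (hX b hbX)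
    exact ih.tail ⟨hadj, hbc.2⟩

/-! ### No admissible vertex of the contracted graph is a cut -/

/-- **From an admissible `𝕋`-route avoiding `z` to a contracted route avoiding `z`** (`z` a
non-fence site): truncate at the first fence site and enter the end point of that fence. [cite: Diestel2017, §1.7] -/
theorem cRoute_of_route (D : IntPairData m N k₀ K T R₀ ω) {z s t : Site 2} (hz : z ∈ D.Bset) (hs : s ∈ D.Bset) (ht : t ∈ D.Tset)
    (h : PathIn triGraph (D.Aset \ {z}) s t) : ∃ t' ∈ D.Tset, PathIn D.cG (D.cA \ {z}) s t' := by
  have hsR : s ∈ (D.FF)ᶜ := D.not_mem_FF_of_mem_Bset hs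
  have htR : t ∉ (D.FF)ᶜ := fun h' => h' (D.Tset_subset_FF ht)
  obtain ⟨a', b, ha', hbR, -, hab, hP⟩ := h.exit (R := (D.FF)ᶜ) hsR htR
  obtain ⟨u, c, zc, hu, hbFu⟩ : b ∈ D.FF := not_not.1 hbR
  have hsub : (D.FF)ᶜ ∩ (D.Aset \ {z}) ⊆ D.cA \ {z} := fun v hv =>
    ⟨Or.inl (D.mem_Bset_of_mem_Aset hv.2.1 hv.1), hv.2.2⟩
  have hP' : PathIn D.cG (D.cA \ {z}) s a' := (D.pathIn_cG_of_pathIn hP fun v hv => hv.1).mono hsub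
  have ha'F : a' ∉ D.FF := ha'
  have hmF : (D.fence hu).m' ∈ D.FF := D.Tset_subset_FF (D.m'_mem_Tset hu)
  have hm : (D.fence hu).m' ∈ D.cA \ {z} :=
    ⟨Or.inr (D.m'_mem_Tset hu), fun hmz => D.not_mem_FF_of_mem_Bset hz (by rw [← Set.mem_singleton_iff.1 hmz]; exact hmF)⟩
  have hadj : D.cG.Adj a' (D.fence hu).m' :=
    ⟨fun h' => ha'F (by rw [h']; exact hmF), Or.inr (Or.inl ⟨ha'F, u, c, zc, hu, rfl, b, hbFu, hab⟩)⟩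
  exact ⟨_, D.m'_mem_Tset hu, hP'.tail hadj hm⟩

/-- **The canonical fence-free route** of the arm `i` to the attachment site of the fence of its
minimal term: along an arm (and inside the term). [cite: Nolin2008, §4.4 Lemma 15 (proof) (arXiv 0711.4948: Lemma 14)] -/
theorem canonical_route (D : IntPairData m N k₀ K T R₀ ω) (i : Fin 2) {c : Finset (Site 2)} {z : Site 2}
    (hu : (intDom m).lowestSeq ω (D.uMin i) = some (c, z)) :
    ∃ i', PathIn triGraph D.Bset (D.b i') (D.fence hu).q := by
  classical
  rcases (D.fence hu).q_mem with hq | ⟨i', hq⟩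
  · obtain ⟨x, hx⟩ := D.αF_meet i hu
    rw [Finset.mem_inter] at hx
    have hxA : x ∈ (D.A i).support := D.αF_subset i x hx.1
    have h1 : PathIn triGraph D.Bset (D.b i) x :=
      PathIn.of_walk ((D.A i).takeUntil x hxA) fun v hv =>
        Or.inl (D.mem_armSet ((D.A i).support_takeUntil_subset_support hxA hv))
    have h2 : PathIn triGraph D.Bset x (D.fence hu).q :=
      ((term_isCrossing hu).conn x hx.2 (D.fence hu).q (Finset.mem_coe.1 hq)).mono fun v hv => Or.inr ⟨_, c, z, hu, hv⟩
    exact ⟨i, h1.trans h2⟩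
  · exact ⟨i', PathIn.of_walk ((D.A i').takeUntil (D.fence hu).q hq) fun v hv =>
      Or.inl (D.mem_armSet ((D.A i').support_takeUntil_subset_support hq hv))⟩

/-- **No admissible vertex of the contracted graph is a cut** (Menger's second hypothesis in
`cG`). [cite: Nolin2008, §4.4 Lemma 15 (proof) (arXiv 0711.4948: Lemma 14, last paragraph)] [cite: Diestel2017, §1.7] -/
theorem hcut_cG (D : IntPairData m N k₀ K T R₀ ω) :
    ∀ zz ∈ D.cA, ∃ (s t : Site 2) (q : D.cG.Walk s t), s ∈ ({D.b 0, D.b 1} : Set (Site 2)) ∧ t ∈ D.Tset ∧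
      (∀ y ∈ q.support, y ∈ D.cA) ∧ zz ∉ q.support := by
  classical
  rintro zz (hzz | hzz)
  · -- a non-fence site: Menger's hypothesis of the `𝕋`-setting, truncated at the first fence site
    obtain ⟨s, t, q, hs, ht, hqA, hzq⟩ := D.menger_hcut zz (D.Bset_subset_Aset hzz)
    have hP : PathIn triGraph (D.Aset \ {zz}) s t :=
      PathIn.of_walk q fun x hx => ⟨hqA x hx, fun h => hzq (by rw [← Set.mem_singleton_iff.1 h]; exact hx)⟩
    have hsB : s ∈ D.Bset := by
      rcases hs with h | h
      · rw [h]; exact D.b_mem_Bset 0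
      · rw [Set.mem_singleton_iff.1 h]; exact D.b_mem_Bset 1
    obtain ⟨t', ht', hP'⟩ := D.cRoute_of_route hzz hsB ht hP
    obtain ⟨w, hw⟩ := hP'.exists_walk
    exact ⟨s, t', w, hs, ht', fun y hy => (hw y hy).1, fun hy => (hw zz hy).2 (Set.mem_singleton zz)⟩
  · -- an end point `m_w`: the canonical route of the arm whose minimal term is not `w`
    obtain ⟨w, cw, zw, hw, rfl⟩ := hzz
    obtain ⟨i, hi⟩ : ∃ i : Fin 2, D.uMin i ≠ w := by
      by_cases h : D.uMin 0 = w
      · exact ⟨1, fun h' => D.uMin_ne (show (0 : Fin 2) ≠ 1 by decide) (h.trans h'.symm)⟩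
      · exact ⟨0, h⟩
    obtain ⟨c, z, hu, -⟩ := D.uMin_spec i
    obtain ⟨i', hroute⟩ := D.canonical_route i hu
    have hqB : (D.fence hu).q ∈ D.Bset := hroute.right_mem
    have hqF : (D.fence hu).q ∉ D.FF := D.not_mem_FF_of_mem_Bset hqB
    have hmuF : (D.fence hu).m' ∈ D.FF := ⟨_, c, z, hu, (D.fence hu).m'_mem⟩
    have hmwF : (D.fence hw).m' ∈ D.FF := ⟨w, cw, zw, hw, (D.fence hw).m'_mem⟩
    have hP : PathIn D.cG (D.cA \ {(D.fence hw).m'}) (D.b i') (D.fence hu).q :=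
      (D.pathIn_cG_of_pathIn hroute fun v hv => D.not_mem_FF_of_mem_Bset hv).mono fun v hv =>
        ⟨Or.inl hv, fun h => D.not_mem_FF_of_mem_Bset hv (by rw [Set.mem_singleton_iff.1 h]; exact hmwF)⟩
    have hmu : (D.fence hu).m' ∈ D.cA \ {(D.fence hw).m'} := by
      refine ⟨Or.inr (D.m'_mem_Tset hu), fun h => ?_⟩
      exact D.fence_disjoint_fence hi hu hw (D.fence hu).m'_mem (by rw [Set.mem_singleton_iff.1 h]; exact (D.fence hw).m'_mem)
    have hadj : D.cG.Adj (D.fence hu).q (D.fence hu).m' :=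
      ⟨fun h => hqF (by rw [h]; exact hmuF),
        Or.inr (Or.inl ⟨hqF, _, c, z, hu, rfl, (D.fence hu).p, (D.fence hu).path.left_mem, (D.fence hu).adj⟩)⟩
    obtain ⟨q, hq⟩ := (hP.tail hadj hmu).exists_walk
    refine ⟨D.b i', (D.fence hu).m', q, ?_, D.m'_mem_Tset hu, fun y hy => (hq y hy).1, fun hy => (hq _ hy).2 (Set.mem_singleton _)⟩
    fin_cases i' <;> simp

/-! ### Two clean routes -/

/-- **Two vertex-disjoint routes, each touching only its own fence** (see the module docstring):
terms `u₀ ≠ u₁`, sets `S₀, S₁` with `PathIn 𝕋 Sᵢ (a i) m_{uᵢ}`, `Sᵢ ⊆ (arms ∪ terms) ∪ F_{uᵢ}`,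
`S₀ ∩ S₁ = ∅`. [cite: Nolin2008, §4.4 Lemma 15 (proof) (arXiv 0711.4948: Lemma 14, last paragraph)] [cite: Diestel2017, Thm. 3.3.1 and §1.7] -/
theorem exists_two_clean_routes (D : IntPairData m N k₀ K T R₀ ω) :
    ∃ (u₀ u₁ : ℕ) (c₀ c₁ : Finset (Site 2)) (z₀ z₁ : Site 2)
      (hu₀ : (intDom m).lowestSeq ω u₀ = some (c₀, z₀)) (hu₁ : (intDom m).lowestSeq ω u₁ = some (c₁, z₁)),
      u₀ ≠ u₁ ∧ ∃ S₀ S₁ : Set (Site 2),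
        PathIn triGraph S₀ (D.b 0) (D.fence hu₀).m' ∧ PathIn triGraph S₁ (D.b 1) (D.fence hu₁).m' ∧
        S₀ ⊆ D.Bset ∪ (D.fence hu₀).F ∧ S₁ ⊆ D.Bset ∪ (D.fence hu₁).F ∧ Disjoint S₀ S₁ := by
  classical
  have hone : ∃ (s t : Site 2) (q : D.cG.Walk s t), s ∈ ({D.b 0, D.b 1} : Set (Site 2)) ∧ t ∈ D.Tset ∧
      ∀ y ∈ q.support, y ∈ D.cA := by
    obtain ⟨s, t, q, hs, ht, hA, -⟩ := D.hcut_cG (D.b 0) (Or.inl (D.b_mem_Bset 0))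
    exact ⟨s, t, q, hs, ht, hA⟩
  obtain ⟨s₁, t₁, s₂, t₂, p₁, p₂, hs₁, ht₁, hs₂, ht₂, -, -, hA₁, hA₂, hdisj⟩ :=
    exists_two_disjoint_paths (G := D.cG) hone D.hcut_cG
  -- finishing a contracted route: truncate at the first end point, enter the fence connection
  have finish : ∀ {s t : Site 2} (p : D.cG.Walk s t), s ∈ D.Bset → t ∈ D.Tset → (∀ y ∈ p.support, y ∈ D.cA) →
      ∃ (u : ℕ) (c : Finset (Site 2)) (z : Site 2) (hu : (intDom m).lowestSeq ω u = some (c, z)) (S : Set (Site 2)),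
        (D.fence hu).m' ∈ p.support ∧ PathIn triGraph S s (D.fence hu).m' ∧ S ⊆ D.Bset ∪ (D.fence hu).F ∧
        S ⊆ {v | v ∈ p.support ∧ v ∈ D.Bset} ∪ (D.fence hu).F := by
    intro s t p hs ht hpA
    have hP : PathIn D.cG {v | v ∈ p.support} s t := PathIn.of_walk p fun x hx => hx
    have hsR : s ∈ (D.Tset)ᶜ := fun h => D.not_mem_FF_of_mem_Bset hs (D.Tset_subset_FF h)
    have htR : t ∉ (D.Tset)ᶜ := fun h => h ht
    obtain ⟨a', b, -, hbR, hbp, hab, hQ⟩ := hP.exit (R := (D.Tset)ᶜ) hsR htR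
    obtain ⟨u, c, z, hu, rfl⟩ : b ∈ D.Tset := not_not.1 hbR
    have hpre : (D.Tset)ᶜ ∩ {v | v ∈ p.support} ⊆ {v | v ∈ p.support ∧ v ∈ D.Bset} := fun v hv =>
      ⟨hv.2, by rcases hpA v hv.2 with h | h; exacts [h, absurd h hv.1]⟩
    have hQ' : PathIn triGraph {v | v ∈ p.support ∧ v ∈ D.Bset} s a' :=
      D.pathIn_of_pathIn_cG (hQ.mono hpre) fun v hv => D.not_mem_FF_of_mem_Bset hv.2
    have ha'F : a' ∉ D.FF := D.not_mem_FF_of_mem_Bset (hpre hQ.right_mem).2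
    have hmF : (D.fence hu).m' ∈ D.FF := D.Tset_subset_FF (D.m'_mem_Tset hu)
    -- the edge `a' → m_u` of `cG` is an adjacency of `a'` to a site `f` of `F_u`
    obtain ⟨f, hfF, haf⟩ : ∃ f ∈ (D.fence hu).F, triGraph.Adj a' f := by
      rcases hab.2 with h | h | h
      · exact absurd hmF h.2.1
      · obtain ⟨u', c', z', hu', hm, f, hf, hadj⟩ := h.2
        have huu : u = u' := by
          by_contra hne
          exact D.fence_disjoint_fence hne hu hu' (D.fence hu).m'_mem (by rw [hm]; exact (D.fence hu').m'_mem)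
        subst huu
        obtain ⟨rfl, rfl⟩ := term_eq hu hu'
        exact ⟨f, hf, hadj⟩
      · exact absurd hmF h.1
    refine ⟨u, c, z, hu, {v | v ∈ p.support ∧ v ∈ D.Bset} ∪ (D.fence hu).F, hbp, ?_, ?_, subset_rfl⟩
    · exact ((hQ'.mono Set.subset_union_left).tail haf (Or.inr hfF)).trans
        (((D.fence hu).pathIn_to_m' hfF).mono Set.subset_union_right)
    · exact Set.union_subset_union_left _ fun v hv => hv.2
  have hsB : ∀ {s : Site 2}, s ∈ ({D.b 0, D.b 1} : Set (Site 2)) → s ∈ D.Bset := by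
    intro s hs
    rcases hs with h | h
    · rw [h]; exact D.b_mem_Bset 0
    · rw [Set.mem_singleton_iff.1 h]; exact D.b_mem_Bset 1
  obtain ⟨v₁, d₁, w₁, hv₁, S₁, hm₁, hP₁, hS₁, hS₁'⟩ := finish p₁ (hsB hs₁) ht₁ hA₁
  obtain ⟨v₂, d₂, w₂, hv₂, S₂, hm₂, hP₂, hS₂, hS₂'⟩ := finish p₂ (hsB hs₂) ht₂ hA₂
  have hv : v₁ ≠ v₂ := by
    rintro rfl
    obtain ⟨rfl, rfl⟩ := term_eq hv₁ hv₂
    exact hdisj _ hm₁ hm₂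
  have hdisjS : Disjoint S₁ S₂ := by
    rw [Set.disjoint_left]
    intro y hy₁ hy₂
    rcases hS₁' hy₁ with h₁ | h₁ <;> rcases hS₂' hy₂ with h₂ | h₂
    · exact hdisj y h₁.1 h₂.1
    · exact D.not_mem_FF_of_mem_Bset h₁.2 ⟨_, _, _, hv₂, h₂⟩
    · exact D.not_mem_FF_of_mem_Bset h₂.2 ⟨_, _, _, hv₁, h₁⟩
    · exact D.fence_disjoint_fence hv hv₁ hv₂ h₁ h₂
  have hs : s₁ ≠ s₂ := fun h => hdisj s₁ p₁.start_mem_support (by rw [h]; exact p₂.start_mem_support)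
  simp only [Set.mem_insert_iff, Set.mem_singleton_iff] at hs₁ hs₂
  rcases hs₁ with rfl | rfl <;> rcases hs₂ with rfl | rfl
  · exact absurd rfl hs
  · exact ⟨v₁, v₂, d₁, d₂, w₁, w₂, hv₁, hv₂, hv, S₁, S₂, hP₁, hP₂, hS₁, hS₂, hdisjS⟩
  · exact ⟨v₂, v₁, d₂, d₁, w₂, w₁, hv₂, hv₁, hv.symm, S₂, S₁, hP₂, hP₁, hS₂, hS₁, hdisjS.symm⟩
  · exact absurd rfl hs

/-- **Sites of a clean route are admissible** (hence open, in the annulus or in the zone of its own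
fence). [folklore] -/
theorem clean_route_subset_Aset (D : IntPairData m N k₀ K T R₀ ω) {u : ℕ} {c : Finset (Site 2)} {z : Site 2}
    (hu : (intDom m).lowestSeq ω u = some (c, z)) {S : Set (Site 2)} (hS : S ⊆ D.Bset ∪ (D.fence hu).F) :
    S ⊆ D.Aset := fun v hv => by
  rcases hS hv with h | h
  · exact D.Bset_subset_Aset h
  · exact D.fence_subset_Aset hu h

/-- **A clean route avoids every other fence.** [folklore] -/
theorem clean_route_disjoint_fence (D : IntPairData m N k₀ K T R₀ ω) {u w : ℕ} (huw : u ≠ w) {c c' : Finset (Site 2)} {z z' : Site 2}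
    (hu : (intDom m).lowestSeq ω u = some (c, z)) (hw : (intDom m).lowestSeq ω w = some (c', z'))
    {S : Set (Site 2)} (hS : S ⊆ D.Bset ∪ (D.fence hu).F) : Disjoint S (D.fence hw).F := by
  rw [Set.disjoint_left]
  intro v hv hvw
  rcases hS hv with h | h
  · exact D.not_mem_FF_of_mem_Bset h ⟨w, c', z', hw, hvw⟩
  · exact D.fence_disjoint_fence huw hu hw h hvw

/-- **Non-fence sites of a clean route have norm `≥ m`** (arms and terms), so the sites of a
clean route inside `Λ_m` belong to its own fence connection. [folklore] -/
theorem clean_route_interior (D : IntPairData m N k₀ K T R₀ ω) {u : ℕ} {c : Finset (Site 2)} {z : Site 2}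
    (hu : (intDom m).lowestSeq ω u = some (c, z)) {S : Set (Site 2)} (hS : S ⊆ D.Bset ∪ (D.fence hu).F)
    {v : Site 2} (hv : v ∈ S) (hvn : triNorm v < m) : v ∈ (D.fence hu).F := by
  rcases hS hv with (h | ⟨u', c', z', hu', h⟩) | h
  · exact absurd (D.armSet_norm_ge h) (not_le.2 hvn)
  · exact absurd (term_norm hu' (Finset.mem_coe.1 h)).1 (not_le.2 hvn)
  · exact h

end IntPairData

end Literature.Probability.Percolation
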